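import Literature.Analysis.FluidPDE.FiniteFourierModeEuler3D
import Literature.Analysis.FluidPDE.FiniteFourierModeEulerFace

/-!
# Kishimoto–Yoneda, Prop. 4.8: the corner case of a non-vertex point on the segment to a vertex

Support file for `FiniteFourierModeEuler` (N. Kishimoto, T. Yoneda, J. Math. Fluid Mech. 24
(2022) 74 = arXiv:2110.08039). In the proof of **Proposition 4.8** the non-vertex point `n₀` of
maximal Minkowski functional `N(n₀) = q` may lie on the segment from the origin to a vertex `b₀`
(`n₀ = q b₀`); the paper then uses an edge `E = [b₀, b₁]` of a face through `b₀`, the point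
`n₁ = b₁`, and the functional `g ≡ 0` on `E`. We PROVE this case in the language of functionals
(`corner_false`): given a generic time, a Beltrami vertex `b₀` strictly exposed by `φ₀`, the
occupied non-Beltrami point `q b₀` (`0 < q ≤ 1`), and `N ≤ q` on all non-Beltrami points, a
contradiction follows — the edge at `b₀` (`KY.exists_exposed_edge_up` for a generic direction)
has exactly one further point `b₁` (Lemma 4.5 (ii), `IsBV.false_of_two_on_ray`), which is
Beltrami by transport; the pair `(q b₀, b₁)` is simply interacting up to non-interacting pairs
(the competitor `b₁ - (1-q) b₀` would have `N ≤ q` and lie over the edge, forcing `q = 1`), so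
`q b₀` would be Beltrami.

## References

* [KishimotoYoneda2022] N. Kishimoto, T. Yoneda, J. Math. Fluid Mech. 24 (2022) 74 =
  arXiv:2110.08039, §4 proof of Prop. 4.8 (the side `E`, the functional `g`, "`|E| = … < |E|`").
-/

noncomputable section

open Matrix Finset Set

namespace Literature.Analysis.FluidPDE

namespace KY

/-- Coefficients with respect to two independent vectors are unique. [folklore] -/
theorem coeff_unique {p r : Fin 3 → ℝ} (hk : p ⨯₃ r ≠ 0) {a b a' b' : ℝ}
    (h : a • p + b • r = a' • p + b' • r) : a = a' ∧ b = b' := by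
  have hr : r ≠ 0 := right_ne_zero_of_cross_ne_zero hk
  have h1 : (a - a') • p = (b' - b) • r := by
    rw [sub_smul, sub_smul]
    have : a • p + b • r - (a' • p + b • r) = a' • p + b' • r - (a' • p + b • r) := by rw [h]
    calc a • p - a' • p = a • p + b • r - (a' • p + b • r) := by abel
      _ = a' • p + b' • r - (a' • p + b • r) := this
      _ = b' • r - b • r := by abel
  have h2 : (a - a') • (p ⨯₃ r) = 0 := by
    rw [← LinearMap.map_smul₂, h1, LinearMap.map_smul, LinearMap.smul_apply, cross_self, smul_zero]
  have ha : a = a' := sub_eq_zero.1 ((smul_eq_zero.1 h2).resolve_right hk)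
  refine ⟨ha, ?_⟩
  rw [ha, sub_self, zero_smul] at h1
  have := (smul_eq_zero.1 h1.symm).resolve_right hr
  linarith [sub_eq_zero.1 this]

/-- A linear functional vanishing on a finite set whose convex hull is a neighbourhood of `0`
vanishes identically. [folklore] -/
theorem eq_zero_of_forall_dot_eq_zero {S : Finset (Fin 3 → ℝ)}
    (hK : convexHull ℝ (S : Set (Fin 3 → ℝ)) ∈ nhds (0 : Fin 3 → ℝ)) {ψ : Fin 3 → ℝ}
    (hψ : ∀ s ∈ S, ψ ⬝ᵥ s = 0) : ψ = 0 := by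
  -- `ψ ≤ 0` and `-ψ ≤ 0` on the hull, hence on a ball around `0`
  have hle : ∀ z ∈ convexHull ℝ (S : Set (Fin 3 → ℝ)), ψ ⬝ᵥ z ≤ 0 :=
    fun z hz => dot_le_of_mem_convexHull (fun s hs => (hψ s hs).le) hz
  have hge : ∀ z ∈ convexHull ℝ (S : Set (Fin 3 → ℝ)), (-ψ) ⬝ᵥ z ≤ 0 :=
    fun z hz => dot_le_of_mem_convexHull (fun s hs => by rw [neg_dotProduct, hψ s hs, neg_zero]) hz
  obtain ⟨ε, hε, hball⟩ := Metric.mem_nhds_iff.1 hK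
  -- test against `δ • ψ`
  by_contra hne
  have hpos : 0 < ψ ⬝ᵥ ψ := lt_of_le_of_ne (by
      rw [real_dot_eq]; nlinarith [sq_nonneg (ψ 0), sq_nonneg (ψ 1), sq_nonneg (ψ 2)])
    (fun h => hne (dotProduct_self_eq_zero.1 h.symm))
  have hnorm : 0 < ‖ψ‖ := norm_pos_iff.2 hne
  set δ : ℝ := ε / (2 * ‖ψ‖) with hδ
  have hδpos : 0 < δ := div_pos hε (by positivity)
  have hmem : δ • ψ ∈ Metric.ball (0 : Fin 3 → ℝ) ε := by
    rw [Metric.mem_ball, dist_zero_right, norm_smul, Real.norm_of_nonneg hδpos.le, hδ]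
    rw [div_mul_eq_mul_div, div_lt_iff₀ (by positivity)]
    nlinarith
  have := hle _ (hball hmem)
  rw [dotProduct_smul, smul_eq_mul] at this
  nlinarith

end KY

namespace KY.IsFiniteModeEulerSolution

open KY

variable {I : Set ℝ} {S : Finset (Fin 3 → ℝ)} {u : (Fin 3 → ℝ) → ℝ → (Fin 3 → ℂ)}

/-- **Prop. 4.8, corner case `n₀ = q b₀`.** See the module docstring.
[cite: KishimotoYoneda2022, §4 proof of Prop. 4.8] -/
theorem corner_false (hS : IsFiniteModeEulerSolution I S u) {t : ℝ} (ht : t ∈ I)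
    (hgen : ∀ n ∈ S, u n t ≠ 0)
    (hK : convexHull ℝ (S : Set (Fin 3 → ℝ)) ∈ nhds (0 : Fin 3 → ℝ))
    {μ : ℝ} {b₀ : Fin 3 → ℝ} (hb₀ : b₀ ∈ S) (hb₀BV : IsBV μ b₀ (u b₀ t))
    {φ₀ : Fin 3 → ℝ} (hstrict : ∀ s ∈ S, s ≠ b₀ → φ₀ ⬝ᵥ s < φ₀ ⬝ᵥ b₀)
    {q : ℝ} (hq0 : 0 < q) (hq1 : q ≤ 1) (hy₀ : q • b₀ ∈ S)
    (hy₀bad : ¬ IsBV μ (q • b₀) (u (q • b₀) t))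
    (hbadgauge : ∀ b ∈ S, ¬ IsBV μ b (u b t) → gauge (convexHull ℝ (S : Set (Fin 3 → ℝ))) b ≤ q) :
    False := by
  classical
  set K := convexHull ℝ (S : Set (Fin 3 → ℝ)) with hKdef
  have hb₀0 : b₀ ≠ 0 := hS.ne_zero_of_mem hb₀
  -- `φ₀ b₀ > 0` and `φ₀ ≠ 0`
  have hφ₀pos : 0 < φ₀ ⬝ᵥ b₀ := by
    have hnb : -b₀ ≠ b₀ := fun h => hb₀0 (by
      have h2 : (2 : ℝ) • b₀ = 0 := by rw [two_smul]; nth_rewrite 1 [← h]; simp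
      exact (smul_eq_zero.1 h2).resolve_left two_ne_zero)
    have := hstrict (-b₀) (hS.neg_mem b₀ hb₀) hnb
    rw [dotProduct_neg] at this; linarith
  have hφ₀0 : φ₀ ≠ 0 := by rintro rfl; simp at hφ₀pos
  obtain ⟨d₀, hd₀0, hd₀φ⟩ : ∃ d₀ : Fin 3 → ℝ, d₀ ≠ 0 ∧ φ₀ ⬝ᵥ d₀ = 0 := by
    by_cases h : φ₀ ⨯₃ ![1, 0, 0] = 0
    · have h' : φ₀ ⨯₃ ![0, 1, 0] ≠ 0 := by
        intro h'
        simp only [cross_apply, Matrix.cons_val_zero, Matrix.cons_val_one, Matrix.head_cons,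
          Matrix.cons_val_two, Matrix.tail_cons, mul_one, mul_zero, sub_zero, zero_sub,
          Matrix.cons_eq_zero_iff, neg_eq_zero, Matrix.zero_empty, and_true, true_and] at h h'
        apply hφ₀0; ext i; fin_cases i
        · exact h'.2
        · exact h.2
        · exact h.1
      exact ⟨_, h', by rw [dot_self_cross]⟩
    · exact ⟨_, h, by rw [dot_self_cross]⟩
  let tie : (Fin 3 → ℝ) → (Fin 3 → ℝ) → (Fin 3 → ℝ) := fun s s' =>
    (φ₀ ⬝ᵥ b₀ - φ₀ ⬝ᵥ s) • (s' - b₀) - (φ₀ ⬝ᵥ b₀ - φ₀ ⬝ᵥ s') • (s - b₀)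
  let D : Finset (Fin 3 → ℝ) :=
    ((((S ×ˢ S).image fun p => p.1 - p.2) ∪ ((S ×ˢ S).image fun p => tie p.1 p.2)) ∪ {d₀}).filter
      fun d => d ≠ 0
  have hD : ∀ d ∈ D, d ≠ 0 := fun d hd => (Finset.mem_filter.1 hd).2
  obtain ⟨w', hw'⟩ := exists_forall_dot_ne_zero D hD
  have hgen_dir : ∀ gd : Fin 3 → ℝ, (∀ d ∈ D, gd ⬝ᵥ d ≠ 0) →
      (∃ s ∈ S, gd ⬝ᵥ b₀ < gd ⬝ᵥ s) → False := by
    intro gd hgd hup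
    have hgD : ∀ d, d ≠ 0 →
        (d ∈ ((S ×ˢ S).image fun p => p.1 - p.2) ∨ d ∈ ((S ×ˢ S).image fun p => tie p.1 p.2)
          ∨ d = d₀) → gd ⬝ᵥ d ≠ 0 := by
      intro d hd0 hmem
      refine hgd d (Finset.mem_filter.2 ⟨?_, hd0⟩)
      rcases hmem with h | h | h
      · exact Finset.mem_union_left _ (Finset.mem_union_left _ h)
      · exact Finset.mem_union_left _ (Finset.mem_union_right _ h)
      · exact Finset.mem_union_right _ (Finset.mem_singleton.2 h)
    obtain ⟨lam, hlam, w₁, hw₁S, hgw₁, hψw₁, hψle, hψeq⟩ := exists_exposed_edge_up hb₀ hstrict hup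
    set ψ : Fin 3 → ℝ := φ₀ + lam • gd with hψdef
    have hw₁b : w₁ ≠ b₀ := by rintro rfl; exact lt_irrefl _ hgw₁
    set e : Fin 3 → ℝ := w₁ - b₀ with hedef
    have he0 : e ≠ 0 := sub_ne_zero.2 hw₁b
    have hψe : ψ ⬝ᵥ e = 0 := by rw [hedef, dotProduct_sub, hψw₁, sub_self]
    have hψray : ∀ θ : ℝ, ψ ⬝ᵥ (b₀ + θ • e) = ψ ⬝ᵥ b₀ := fun θ => by
      rw [dotProduct_add, dotProduct_smul, hψe, smul_zero, add_zero]
    have hcx : ∀ s ∈ S, s ≠ b₀ → 0 < φ₀ ⬝ᵥ b₀ - φ₀ ⬝ᵥ s := fun s hs hsb => sub_pos.2 (hstrict s hs hsb)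
    let θf : (Fin 3 → ℝ) → ℝ := fun s => (φ₀ ⬝ᵥ b₀ - φ₀ ⬝ᵥ s) / (φ₀ ⬝ᵥ b₀ - φ₀ ⬝ᵥ w₁)
    have hray : ∀ s ∈ S, ψ ⬝ᵥ s = ψ ⬝ᵥ b₀ → s ≠ b₀ → 0 < θf s ∧ s = b₀ + θf s • e := by
      intro s hs hψs hsb
      refine ⟨div_pos (hcx s hs hsb) (hcx w₁ hw₁S hw₁b), ?_⟩
      have h0 : gd ⬝ᵥ tie w₁ s = 0 := tie_vector_eq_zero hψw₁ hψs
      have hz : tie w₁ s = 0 := by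
        by_contra hne
        refine hgD _ hne (Or.inr (Or.inl (Finset.mem_image.2 ⟨(w₁, s), ?_, rfl⟩))) h0
        simp [hw₁S, hs]
      have heq : (φ₀ ⬝ᵥ b₀ - φ₀ ⬝ᵥ w₁) • (s - b₀) = (φ₀ ⬝ᵥ b₀ - φ₀ ⬝ᵥ s) • e := sub_eq_zero.1 hz
      have hc : φ₀ ⬝ᵥ b₀ - φ₀ ⬝ᵥ w₁ ≠ 0 := (hcx w₁ hw₁S hw₁b).ne'
      have : s - b₀ = θf s • e := by
        rw [show θf s = (φ₀ ⬝ᵥ b₀ - φ₀ ⬝ᵥ s) / (φ₀ ⬝ᵥ b₀ - φ₀ ⬝ᵥ w₁) from rfl, div_eq_inv_mul,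
          mul_smul, ← heq, smul_smul, inv_mul_cancel₀ hc, one_smul]
      rw [← this]; abel
    have hray' : ∀ s ∈ S, ψ ⬝ᵥ s = ψ ⬝ᵥ b₀ → ∃ θ : ℝ, 0 ≤ θ ∧ s = b₀ + θ • e := by
      intro s hs hψs
      by_cases hsb : s = b₀
      · exact ⟨0, le_rfl, by rw [hsb, zero_smul, add_zero]⟩
      · obtain ⟨hpos, heq⟩ := hray s hs hψs hsb
        exact ⟨θf s, hpos.le, heq⟩
    have hparam_unique : ∀ θ θ' : ℝ, b₀ + θ • e = b₀ + θ' • e → θ = θ' := by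
      intro θ θ' h
      have h' : (θ - θ') • e = 0 := by rw [sub_smul, sub_eq_zero]; exact add_left_cancel h
      exact sub_eq_zero.1 ((smul_eq_zero.1 h').resolve_right he0)
    -- `ψ ≠ 0` (genericity: `gd ∦ φ₀`) and `ψ b₀ > 0`
    have hψne : ψ ≠ 0 := by
      intro h0
      have : gd ⬝ᵥ d₀ = 0 := by
        have h1 : ψ ⬝ᵥ d₀ = 0 := by rw [h0, zero_dotProduct]
        rw [hψdef, add_dotProduct, smul_dotProduct, smul_eq_mul, hd₀φ, zero_add] at h1
        exact (mul_eq_zero.1 h1).resolve_left hlam.ne'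
      exact hgD d₀ hd₀0 (Or.inr (Or.inr rfl)) this
    have hM : 0 < ψ ⬝ᵥ b₀ := by
      have hle := hψle (-b₀) (hS.neg_mem b₀ hb₀)
      rw [dotProduct_neg] at hle
      rcases (show 0 ≤ ψ ⬝ᵥ b₀ by linarith).lt_or_eq with hpos | hzero
      · exact hpos
      · exfalso
        apply hψne
        apply eq_zero_of_forall_dot_eq_zero hK
        intro s hs
        have h1 := hψle s hs
        have h2 := hψle (-s) (hS.neg_mem s hs)
        rw [dotProduct_neg] at h2
        linarith
    -- `ψ` is bounded by `ψ b₀` on the hull, hence `ψ c ≤ N(c) ψ b₀`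
    have hψK : ∀ z ∈ K, ψ ⬝ᵥ z ≤ ψ ⬝ᵥ b₀ := fun z hz => dot_le_of_mem_convexHull hψle hz
    have hψgauge : ∀ c ∈ S, ¬ IsBV μ c (u c t) → ψ ⬝ᵥ c ≤ q * (ψ ⬝ᵥ b₀) := by
      intro c hc hcbad
      have hc0 : c ≠ 0 := hS.ne_zero_of_mem hc
      have hr : 0 < gauge K c := gauge_convexHull_pos hK hc0
      have hmem : (gauge K c)⁻¹ • c ∈ K := inv_smul_mem_convexHull_of_gauge_le hK hr le_rfl
      have h1 := hψK _ hmem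
      rw [dotProduct_smul, smul_eq_mul, inv_mul_le_iff₀ hr] at h1
      have h2 := hbadgauge c hc hcbad
      nlinarith
    set T := S.filter fun s => ψ ⬝ᵥ s = ψ ⬝ᵥ b₀ ∧ s ≠ b₀ with hT
    have hw₁T : w₁ ∈ T := Finset.mem_filter.2 ⟨hw₁S, hψw₁, hw₁b⟩
    set P := T.image θf with hP
    have hPne : P.Nonempty := ⟨θf w₁, Finset.mem_image_of_mem _ hw₁T⟩
    have hPpos : ∀ θ ∈ P, 0 < θ := by
      intro θ hθ
      obtain ⟨s, hs, rfl⟩ := Finset.mem_image.1 hθ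
      obtain ⟨hsS, hψs, hsb⟩ := Finset.mem_filter.1 hs
      exact (hray s hsS hψs hsb).1
    have hPmem : ∀ θ ∈ P, b₀ + θ • e ∈ S := by
      intro θ hθ
      obtain ⟨s, hs, rfl⟩ := Finset.mem_image.1 hθ
      obtain ⟨hsS, hψs, hsb⟩ := Finset.mem_filter.1 hs
      rw [← (hray s hsS hψs hsb).2]; exact hsS
    have hparam : ∀ θ : ℝ, 0 < θ → b₀ + θ • e ∈ S → θ ∈ P := by
      intro θ hθ hmem
      have hsb : b₀ + θ • e ≠ b₀ := by
        intro h
        have : θ • e = 0 := by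
          have h' : b₀ + θ • e = b₀ + 0 := by rw [h, add_zero]
          exact add_left_cancel h'
        exact smul_ne_zero hθ.ne' he0 this
      have hsT : b₀ + θ • e ∈ T := Finset.mem_filter.2 ⟨hmem, hψray θ, hsb⟩
      have heq := (hray _ hmem (hψray θ) hsb).2
      rw [hparam_unique θ _ heq]
      exact Finset.mem_image_of_mem _ hsT
    have hparam0 : ∀ θ : ℝ, b₀ + θ • e ∈ S → 0 ≤ θ := by
      intro θ hmem
      obtain ⟨θ', hθ', heq⟩ := hray' _ hmem (hψray θ)
      rw [hparam_unique θ θ' heq]; exact hθ'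
    have hbe : b₀ ⨯₃ e ≠ 0 := by
      intro h0
      have hdep : ¬ LinearIndependent ℝ ![b₀, e] := fun hli =>
        (crossProduct_ne_zero_iff_linearIndependent.2 hli) h0
      rw [LinearIndependent.pair_iff' hb₀0] at hdep
      simp only [not_forall, not_not] at hdep
      obtain ⟨c, hc⟩ := hdep
      have : c * (ψ ⬝ᵥ b₀) = 0 := by
        have h := hψe
        rwa [← hc, dotProduct_smul, smul_eq_mul] at h
      rcases mul_eq_zero.1 this with hc0 | hψ0
      · apply he0; rw [← hc, hc0, zero_smul]
      · exact absurd hψ0 hM.ne'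
    set θa := P.min' hPne with hθa
    have hθaP : θa ∈ P := P.min'_mem hPne
    have hθapos : 0 < θa := hPpos _ hθaP
    have hfirst : ∀ θ : ℝ, 0 < θ → b₀ + θ • e ∈ S → θa ≤ θ :=
      fun θ hθ hmem => P.min'_le θ (hparam θ hθ hmem)
    obtain ⟨hsum₁, huniq₁⟩ := sip_endpoint_next (S := S) hM hψle hray' hψe he0 hfirst
    set b₁ := b₀ + θa • e with hb₁
    have hb₁S : b₁ ∈ S := hPmem _ hθaP
    have hb₁ne : b₀ ≠ b₁ := by
      intro h
      have h' : b₀ + 0 = b₀ + θa • e := by rw [add_zero, ← hb₁]; exact h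
      exact smul_ne_zero hθapos.ne' he0 (add_left_cancel h').symm
    have hNI₁ := hS.nonInteracting_of_sip hb₀ hb₁S hb₁ne hsum₁ huniq₁ ht
    by_cases hmany : (P.erase θa).Nonempty
    · -- two further points: contradiction with Lemma 4.5 (ii)
      set θb := (P.erase θa).min' hmany with hθb
      have hθbmem := (P.erase θa).min'_mem hmany
      obtain ⟨hθbne, hθbP⟩ := Finset.mem_erase.1 hθbmem
      have hsecond : ∀ θ : ℝ, 0 < θ → θ ≠ θa → b₀ + θ • e ∈ S → θb ≤ θ :=
        fun θ hθ hne hmem => (P.erase θa).min'_le θ (Finset.mem_erase.2 ⟨hne, hparam θ hθ hmem⟩)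
      obtain ⟨hsum₂, huniq₂⟩ :=
        sip_endpoint_second (S := S) (θ₂ := θa) (θ₃ := θb) hM hψle hray' hψe he0 hsecond
      have hb₂S : b₀ + θb • e ∈ S := hPmem _ hθbP
      have hb₂ne : b₀ ≠ b₀ + θb • e := by
        intro h
        have h' : b₀ + 0 = b₀ + θb • e := by rw [add_zero]; exact h
        exact smul_ne_zero (hPpos _ hθbP).ne' he0 (add_left_cancel h').symm
      have hNI₂ := hS.nonInteracting_of_sip hb₀ hb₂S hb₂ne hsum₂ huniq₂ ht
      exact hb₀BV.false_of_two_on_ray hbe hθapos.ne' (hPpos _ hθbP).ne' hθbne.symm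
        (hgen _ hb₁S) (hgen _ hb₂S) (hS.div_free _ hb₁S t ht) (hS.div_free _ hb₂S t ht) hNI₁ hNI₂
    · -- exactly one further point `b₁`, which is Beltrami; the pair `(q b₀, b₁)`
      have hPeq : ∀ θ ∈ P, θ = θa := by
        intro θ hθ
        by_contra hne
        exact hmany ⟨θ, Finset.mem_erase.2 ⟨hne, hθ⟩⟩
      have hk₁ : b₀ ⨯₃ b₁ ≠ 0 := by
        rw [hb₁, cross_self_add_smul]; exact smul_ne_zero hθapos.ne' hbe
      have hb₁BV : IsBV μ b₁ (u b₁ t) :=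
        hb₀BV.transport hk₁ (hgen b₁ hb₁S) (hS.div_free b₁ hb₁S t ht) hNI₁
      -- the tie set is `{b₀, b₁}`
      have htie : ∀ s ∈ S, ψ ⬝ᵥ s = ψ ⬝ᵥ b₀ → s = b₀ ∨ s = b₁ := by
        intro s hs hψs
        by_cases hsb : s = b₀
        · exact Or.inl hsb
        · obtain ⟨hpos, heq⟩ := hray s hs hψs hsb
          right
          have hθP : θf s ∈ P := Finset.mem_image_of_mem _ (Finset.mem_filter.2 ⟨hs, hψs, hsb⟩)
          rw [heq, hPeq _ hθP]
      have hyne : q • b₀ ≠ b₁ := fun h => hy₀bad (h ▸ hb₁BV)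
      have hsum : q • b₀ + b₁ ∉ S := by
        intro hmem
        have := hψle _ hmem
        rw [dotProduct_add, dotProduct_smul, smul_eq_mul, hb₁, hψray] at this
        nlinarith
      have hNI : NonInteracting (q • b₀) b₁ (u (q • b₀) t) (u b₁ t) := by
        refine hS.nonInteracting_of_others_vanish hy₀ hb₁S hyne hsum ht ?_
        intro c hc e' he' hce hsum' h1 h2
        -- a non-Beltrami member of the pair leads to a contradiction
        have key : ∀ c ∈ S, ∀ e' ∈ S, c + e' = q • b₀ + b₁ → ¬ (c = q • b₀ ∧ e' = b₁) →
            ¬ IsBV μ c (u c t) → False := by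
          intro c hc e' he' hs hnot hcbad
          have hψc := hψgauge c hc hcbad
          have hψe' := hψle e' he'
          have hs' : ψ ⬝ᵥ c + ψ ⬝ᵥ e' = q * ψ ⬝ᵥ b₀ + ψ ⬝ᵥ b₀ := by
            rw [← dotProduct_add, hs, dotProduct_add, dotProduct_smul, smul_eq_mul, hb₁, hψray]
          have hψc' : ψ ⬝ᵥ c = q * ψ ⬝ᵥ b₀ := by linarith
          have hψe'' : ψ ⬝ᵥ e' = ψ ⬝ᵥ b₀ := by linarith
          rcases htie e' he' hψe'' with he | he
          · -- `e' = b₀`, `c = q b₀ + b₁ - b₀ = q b₀ + θa e`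
            have hceq : c = q • b₀ + θa • e := by
              have : c = q • b₀ + b₁ - e' := by rw [← hs]; abel
              rw [this, he, hb₁]; abel
            -- `c / q` lies in the hull and on the face `{ψ = ψ b₀}`, i.e. on the segment `[b₀, b₁]`
            have hc0 : c ≠ 0 := hS.ne_zero_of_mem hc
            have hgc : gauge K c ≤ q := hbadgauge c hc hcbad
            have hcK : q⁻¹ • c ∈ K :=
              inv_smul_mem_convexHull_of_gauge_le hK hq0 hgc
            have hψcq : ψ ⬝ᵥ (q⁻¹ • c) = ψ ⬝ᵥ b₀ := by
              rw [dotProduct_smul, smul_eq_mul, hψc', ← mul_assoc, inv_mul_cancel₀ hq0.ne', one_mul]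
            have hface := mem_convexHull_filter_of_dot_eq_max hψle hcK hψcq
            have hfilt : (S.filter fun s => ψ ⬝ᵥ s = ψ ⬝ᵥ b₀) = {b₀, b₁} := by
              ext s
              simp only [Finset.mem_filter, Finset.mem_insert, Finset.mem_singleton]
              constructor
              · rintro ⟨hs, hψs⟩; exact htie s hs hψs
              · rintro (rfl | rfl)
                · exact ⟨hb₀, rfl⟩
                · exact ⟨hb₁S, by rw [hb₁, hψray]⟩
            rw [hfilt, Finset.coe_insert, Finset.coe_singleton, convexHull_pair] at hface
            obtain ⟨α, β, hα, hβ, hαβ, hcomb⟩ := hface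
            -- compare coefficients of `b₀` and `e`
            have hcq : q⁻¹ • c = b₀ + (q⁻¹ * θa) • e := by
              rw [hceq, smul_add, smul_smul, smul_smul, inv_mul_cancel₀ hq0.ne', one_smul]
            have hlhs : α • b₀ + β • b₁ = (α + β) • b₀ + (β * θa) • e := by
              rw [hb₁, smul_add, smul_smul, add_smul]; abel
            rw [hlhs, hαβ, one_smul, hcq] at hcomb
            have hcomb' : (1 : ℝ) • b₀ + (β * θa) • e = (1 : ℝ) • b₀ + (q⁻¹ * θa) • e := by
              rw [one_smul]; exact hcomb
            obtain ⟨-, hcoef⟩ := coeff_unique hbe hcomb'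
            have hβq : β = q⁻¹ := mul_right_cancel₀ hθapos.ne' hcoef
            have hq1' : q = 1 := by
              have : q⁻¹ ≤ 1 := by rw [← hβq]; linarith
              have := (inv_le_one₀ hq0).1 this
              linarith
            -- then `c = b₁` is Beltrami
            apply hcbad
            rw [hceq, hq1', one_smul, ← hb₁]; exact hb₁BV
          · -- `e' = b₁`, `c = q b₀`: the excluded pair
            apply hnot
            refine ⟨?_, he⟩
            have : c = q • b₀ + b₁ - e' := by rw [← hs]; abel
            rw [this, he]; abel
        by_cases hcbad : IsBV μ c (u c t)
        · by_cases hebad : IsBV μ e' (u e' t)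
          · exact hcbad.nonInteracting hebad (hS.ne_zero_of_mem hc) (hS.ne_zero_of_mem he')
          · exfalso
            refine key e' he' c hc (by rw [add_comm]; exact hsum') (fun h => h2 ⟨h.2, h.1⟩) hebad
        · exfalso
          exact key c hc e' he' hsum' h1 hcbad
      -- `q b₀` would be Beltrami
      have hk : b₁ ⨯₃ (q • b₀) ≠ 0 := by
        rw [LinearMap.map_smul, ← cross_anticomm b₀ b₁, smul_neg, neg_ne_zero]
        exact smul_ne_zero hq0.ne' hk₁
      exact hy₀bad (hb₁BV.transport hk (hgen _ hy₀) (hS.div_free _ hy₀ t ht)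
        ((nonInteracting_comm b₁ (q • b₀) _ _).1 hNI))
  by_cases hup : ∃ s ∈ S, w' ⬝ᵥ b₀ < w' ⬝ᵥ s
  · exact hgen_dir w' hw' hup
  · refine hgen_dir (-w') (fun d hd => by rw [neg_dotProduct, neg_ne_zero]; exact hw' d hd) ?_
    refine ⟨-b₀, hS.neg_mem b₀ hb₀, ?_⟩
    simp only [neg_dotProduct, dotProduct_neg, neg_neg]
    push Not at hup
    have h1 := hup (-b₀) (hS.neg_mem b₀ hb₀)
    rw [dotProduct_neg] at h1
    -- `w' (-b₀) ≠ w' b₀` by genericity (difference vector `-b₀ - b₀ ≠ 0`)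
    have hne : w' ⬝ᵥ (-b₀ - b₀) ≠ 0 := by
      refine hw' _ (Finset.mem_filter.2 ⟨?_, ?_⟩)
      · exact Finset.mem_union_left _ (Finset.mem_union_left _
          (Finset.mem_image.2 ⟨(-b₀, b₀), Finset.mem_product.2 ⟨hS.neg_mem b₀ hb₀, hb₀⟩, rfl⟩))
      · intro h0
        have : (2 : ℝ) • b₀ = 0 := by
          rw [two_smul]; have := neg_eq_zero.2 h0; rw [neg_sub, sub_neg_eq_add] at this; exact this
        exact hb₀0 ((smul_eq_zero.1 this).resolve_left two_ne_zero)
    rw [dotProduct_sub, dotProduct_neg] at hne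
    rcases lt_or_eq_of_le h1 with h | h
    · linarith
    · exfalso; apply hne; linarith

end KY.IsFiniteModeEulerSolution

end Literature.Analysis.FluidPDE
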